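import Summits.QuantumFields.BalabanUV.Beta.FP.CombSlicePathInverse
import Summits.QuantumFields.BalabanUV.Beta.FP.CombSliceJetLetters
import Summits.QuantumFields.BalabanUV.Beta.FP.NestedStepLawOneShotLetters

/-!
# `BalabanUV.Beta.FP.TorusOneShotFPExponential` — road «FP» for binder row D1, ROUTE T, presentation T-β: **THE ONE-SHOT (BIG-COMB AXIAL)
# FADDEEV–POPOV 2-JET VANISHES IDENTICALLY FOR THE EXPONENTIAL GENERATOR JETS, ALONG EVERY DIRECTION — `uP♯` is automatic; the one-shot dead rows
# `p1 p2` (hence `h + Dλ = 0` on the big comb) are NOT needed on the Faddeev–Popov side**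

WHY ([folklore]; the axial-gauge remark made exact for OUR stripped jets).  In the big comb's own basis the one-shot FP matrix of the torus call,
`P · W^{[uw]}` = (big-comb coordinate rows) × (the parallel-transporter generator `ξ ↦ e^{−cuw_b}·ξ(tip b) − ξ(base b)`), is TRIANGULAR along the comb
forest, with diagonal entry `e^{−cuw_b}` on a tip-oriented comb bond and `−1` on a base-oriented one; so `log|det(P·W^{[uw]})| = −cu·Σ'_b w_b` is LINEAR
in `u` and its second variation VANISHES — for every weight `w`, with no comb-support hypothesis.  At jet level this is the per-site identity
`d₀·d₂ = d₁²` (`1·(cw)² = (−cw)²` tip-oriented, `(−1)·0 = 0²` base-oriented) of leaf-06 g16's `CombSliceJetLetters.secondVar_combRowsT_jets_eq_zero`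
(p310409, over the OWNER's `ForestTriangularJets` p309752), for the EXPONENTIAL generator jets `W₁ = −c·diag(w)·Tip`, `W₂ = (c·diag w)²·Tip` — exactly
the closed forms of `TorusGeneratorIntertwining(Two)` (p320573 ∕ p323313).  This module carries that identity to the torus call's own literal
(the `Res′ ⊕ Res` basis of p313662 ∕ (B) p320614 ∕ S1 `NestedStepLawTransported._of_uni` p321366):
* §1 `tdelta_quo_split`, **`eval_eq`**: evaluation of the nested gauge modes at lattice points = evaluation of the big-comb modes re-indexed by
  `resBigEquiv`, times the unipotent `evalC` (the point-evaluation twin of `TorusCombNestedBasis.W0_eq`);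
* §2 **`bigComb_P_mul_eval_eq`**: `P · of(f b · Tip b e) = (combRowsT″ · D_f↾Res″)∘(e.symm, e.symm) · evalC` with the TIP-TYPE generator matrix
  `D_f q s := Sum.elim (fun a => f (q.1, a)·tdelta (q.1 + e_a) s) (fun _ => 0) q.2` (twin of `CombSlicePathInverse.bigComb_PW0_eq`);
* §3 **`secondVar_combRowsT_expJets_eq_zero`** (ANY comb `ρ N` on ANY torus `M`, ANY weight `w`): the forest letters for `(tgrad, D_{−cw}, D_{(cw)²})` —
  comb-locality, diagonal `±1`, per-site square — hence `secondVar (T·tgrad↾) (T·D_{−cw}↾) (T·D_{(cw)²}↾) = 0`;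
* §4 **`torus_uP_exp`**: at the call's literal (`hP hD₁ hD₂` VERBATIM), for EVERY `w` and `c`, with `W₁ = of(−(c·w b·Tip b e))`, `W₂ = of((c·w b)²·Tip b e)`:
  `secondVar (P * fromCols D₂ D₁) (P * W₁) (P * W₂) = 0` — the `uP♯` binder of `…_of_uni` at `W♯₀ := W₀`, `W♯ₙ := Wₙ^{(h+Dλ)}` for ANY `h λ`.
CONSEQUENCE (with p320573 `torus_j1 ∕ torus_uC_exp`, p323313 `torus_j2`): the ONE-SHOT side of the (B) call's generator letters needs NO hypothesis
(`j1 j2 uC` exact, `uP♯` automatic; `λ` free); the NESTED side keeps `s1 s2` (the nested gauge itself) and the coarse `t1 t2` (the AVERAGED direction on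
the coarse comb — not automatic: the coarse jets average `h²`, not `(avg h)²`; TID § B (v-H)).  Grading-blind (no transpose of an odd object; R-FP-54′).

HONEST DEPENDENCY (page 1, mandatory): continuum YM on T⁴ ⇐ BetaPertH ∧ nine spine estimates (0/9 proved); BetaPertH ⇐ (D1) ∧ (D4) ∧ CAP+tail;
G-an2-4 gates asym, D1 and NE2/3/4.  HONEST FRAMING (cell contract, verbatim): «discharging `BetaPertH` makes Bałaban's UV stability UNCONDITIONAL —
a real constructive-QFT result; it is NOT the continuum limit and NOT the Clay problem.»  ABSOLUTE RULE (cell charter, verbatim): «No internally-minted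
statement may enter as a cited fact. Every hypothesis is either kernel-proved in this package or a verbatim quotation of a PUBLISHED theorem with page
reference. The manuscript(s) under audit are NOT citable for their own disputed steps — they are the thing under adjudication; programme-internal
(2001/route/tribunal) claims are never citable.»  [folklore] forest ∕ comb algebra on OUR typed torus objects; the exponential jets are DISPLAYED hypotheses;
no `def`, no `def … : Prop`, nothing cited, 0 sorry; 0 estimates; 0∕4 row-D1 binders; NOT the dictionary, NOT (T-ID), NOT SDF, NOT D1, NOT BetaPertH,
NOT continuum, NOT Clay.  «not in print; our bookkeeping».
Provenance: D1 formalisation swarm LEAF PROVER 06, unit b2b-balaban-beta-d1-formalise-leaf-06 gen 19, 2026-08-22 (INTENT 2).  No existing file touched.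
-/

noncomputable section

open scoped BigOperators

namespace Summit.QuantumFields.BalabanUV.Beta.FP.TorusOneShotFPExponential

open Finset Matrix
open Literature.MathematicalPhysics.QuantumFieldTheory.Balaban1983to89
open Literature.MathematicalPhysics.QuantumFieldTheory.Balaban1983to89.Beta
open Literature.MathematicalPhysics.QuantumFieldTheory.LatticeForm (quo)
open B5Prop11Plancherel (fine)
open B6Lemma24Torus (pbox mem_pbox)
open AffineAveraging (Site box toSite unitVec)
open OneStepResolventKernel (Fib)
open Summit.QuantumFields.BalabanUV.Beta.D1BFx.LogDetSecondVariation (secondVar)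
open Summit.QuantumFields.BalabanUV.Beta.FP.KernelPeriodisationFib (Idx)
open Summit.QuantumFields.BalabanUV.Beta.FP.TorusCombForest (rootOf depth stepOf axisOf baseOf tipOf base_tip_of_lt base_tip_of_not_lt depth_stepOf_lt)
open Summit.QuantumFields.BalabanUV.Beta.FP.TorusCombRows (Res combBondT combRowsT combBondT_eq baseOf_mem_pbox tipOf_mem_pbox tgrad_combBondT)
open Summit.QuantumFields.BalabanUV.Beta.FP.TorusCombNestedBasis (resBigEquiv evalE evalC det_evalC bigRoot_bounds fine_dvd lift_mem_pbox lift_eq_rootOf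
  lift_quo_of_root quo_lift quo_mem_pbox submatrix_mul_submatrix combRowsT_fieldSlot_mul)
open Summit.QuantumFields.BalabanUV.Beta.FP.TorusGaugeCovariance (tdelta tgrad tdelta_of_mem)
open Summit.QuantumFields.BalabanUV.Beta.FP.TorusGaugeCovariancePairing (wrapPt sum_tdelta_mul)
open Summit.QuantumFields.BalabanUV.Beta.FP.TorusGaugeCovarianceCoarse (tgradBlock tdelta_quo_wrapPt)
open Summit.QuantumFields.BalabanUV.Beta.GAN24.FineReadoutCauchyFrame (toSite_mem_range)
open Summit.QuantumFields.BalabanUV.Beta.FP.CombSlicePathInverse (bigComb_PW0_eq)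
open Summit.QuantumFields.BalabanUV.Beta.FP.CombSliceJetLetters (secondVar_combRowsT_jets_eq_zero)
open Summit.QuantumFields.BalabanUV.Beta.FP.NestedStepLawOneShot (secondVar_submatrix_equiv)
open Summit.QuantumFields.BalabanUV.Beta.FP.NestedStepLawOneShotLetters (secondVar_mul_right)

variable {d : ℕ}

/-! ## §1 Point evaluation of the nested gauge modes = point evaluation of the big-comb modes, re-indexed, times the unipotent `evalC` -/

section Eval

variable {N N₂ : ℕ} {ρ ρ₂ : Site (d + 1)} {M' : Fin (d + 1) → ℕ} [∀ μ, NeZero (M' μ)] [NeZero N]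

/-- [folklore] **THE BLOCK INDICATOR AT A LATTICE POINT SPLITS OVER THE BLOCK's SMALL ROOT AND ITS SMALL NON-ROOTS** (the `tdelta` twin of
`TorusCombNestedBasis.tgradBlock_split`): `tdelta M′ (quo N y) ↑t̄ = tdelta (fine N M′) y (N•t̄ + ρ) + Σ_{s ∈ Res ρ N} [quo N s = t̄] · tdelta (fine N M′) y s`. -/
theorem tdelta_quo_split (hN : 0 < N) (hρ : ∀ i, 0 ≤ ρ i ∧ ρ i < N) (y : Site (d + 1)) (t : Res ρ₂ N₂ M') :
    tdelta M' (quo N y) t.1 = tdelta (fine N M') y ⟨(N : ℤ) • t.site + ρ, lift_mem_pbox hN hρ t.mem⟩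
      + ∑ s : Res ρ N (fine N M'), evalE N N₂ ρ ρ₂ M' s t * tdelta (fine N M') y s.1 := by
  have hsum : ∑ s : ↥(pbox (fine N M')), tdelta (fine N M') y s * tdelta M' (quo N (s : Site (d + 1))) t.1 = tdelta M' (quo N y) t.1 := by
    rw [sum_tdelta_mul, tdelta_quo_wrapPt]
  rw [← hsum]
  -- split the sum over the fine box into small roots and small non-roots
  rw [← Fintype.sum_subtype_add_sum_subtype (fun s : ↥(pbox (fine N M')) => (s : Site (d + 1)) ≠ rootOf ρ N s)
    (fun s => tdelta (fine N M') y s * tdelta M' (quo N (s : Site (d + 1))) t.1)]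
  rw [add_comm]
  congr 1
  · -- the small roots: exactly one of them has block index `t̄`
    rw [Finset.sum_eq_single (⟨⟨(N : ℤ) • t.site + ρ, lift_mem_pbox hN hρ t.mem⟩, fun h => h (lift_eq_rootOf hN hρ t.site)⟩ :
      {s : ↥(pbox (fine N M')) // ¬ (s : Site (d + 1)) ≠ rootOf ρ N s})]
    · show tdelta (fine N M') y _ * tdelta M' (quo N ((N : ℤ) • t.site + ρ)) t.1 = _
      rw [quo_lift hN hρ, tdelta_of_mem M' t.mem t.1, if_pos rfl, mul_one]
    · intro s _ hs
      have hroot : (s.1 : Site (d + 1)) = rootOf ρ N s.1 := not_not.1 s.2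
      rw [tdelta_of_mem M' (quo_mem_pbox hN s.1.2) t.1, if_neg, mul_zero]
      intro hq
      apply hs
      apply Subtype.ext; apply Subtype.ext
      show (s.1 : Site (d + 1)) = (N : ℤ) • t.site + ρ
      rw [← lift_quo_of_root hroot, hq]
    · intro h; exact absurd (Finset.mem_univ _) h
  · -- the small non-roots = `Res ρ N (fine N M')`
    refine Finset.sum_congr rfl fun s _ => ?_
    rw [tdelta_of_mem M' (quo_mem_pbox hN s.1.2) t.1, mul_comm]
    rfl

/-- [folklore] **POINT EVALUATION OF THE NESTED MODES = POINT EVALUATION OF THE BIG-COMB MODES, RE-INDEXED, TIMES `evalC`** (the point-evaluation twin of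
`TorusCombNestedBasis.W0_eq`): for any family of lattice points `y : β → Site`, the matrix `(b, e) ↦ (value of the nested mode e at y b)` — `tdelta M′ (quo N (y b)) t̄`
on a block mode, `tdelta (fine N M′) (y b) s` on a fine residual mode — equals `(b, x″) ↦ tdelta (fine N M′) (y b) x″` (the big-comb modes `δ_{x″}`) re-indexed
by `resBigEquiv`, times `evalC`. -/
theorem eval_eq (hN : 0 < N) (hρ : ∀ i, 0 ≤ ρ i ∧ ρ i < N) (hN₂ : 0 < N₂) (hρ₂ : ∀ i, 0 ≤ ρ₂ i ∧ ρ₂ i < N₂) {β : Type*} (y : β → Site (d + 1)) :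
    (Matrix.of fun (b : β) (e : Res ρ₂ N₂ M' ⊕ Res ρ N (fine N M')) =>
        Sum.elim (fun t : Res ρ₂ N₂ M' => tdelta M' (quo N (y b)) t.1) (fun s : Res ρ N (fine N M') => tdelta (fine N M') (y b) s.1) e)
      = (Matrix.of fun (b : β) (x : Res ((N : ℤ) • ρ₂ + ρ) (N * N₂) (fine N M')) => tdelta (fine N M') (y b) x.1).submatrix id
          (resBigEquiv N N₂ ρ ρ₂ M' hN hρ hN₂ hρ₂).symm
        * evalC N N₂ ρ ρ₂ M' := by
  ext b e
  rw [Matrix.mul_apply, Fintype.sum_sum_type]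
  rcases e with t | s
  · -- block mode
    simp only [Matrix.of_apply, Sum.elim_inl, Matrix.submatrix_apply, id_eq, evalC, Matrix.fromBlocks_apply₁₁, Matrix.fromBlocks_apply₂₁,
      Matrix.one_apply, mul_ite, mul_one, mul_zero, Finset.sum_ite_eq', Finset.mem_univ, if_true]
    rw [tdelta_quo_split hN hρ (y b) t]
    congr 1
    exact Finset.sum_congr rfl fun s _ => by rw [mul_comm]; rfl
  · -- fine residual mode
    simp only [Matrix.of_apply, Sum.elim_inr, Matrix.submatrix_apply, id_eq, evalC, Matrix.fromBlocks_apply₁₂, Matrix.fromBlocks_apply₂₂,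
      Matrix.zero_apply, mul_zero, Finset.sum_const_zero, zero_add, Matrix.one_apply, mul_ite, mul_one, Finset.sum_ite_eq', Finset.mem_univ, if_true]
    rfl

end Eval

/-! ## §2 The one-shot slice against a TIP-TYPE generator jet factors through the big comb's own basis -/

section BigComb

variable {N N₂ : ℕ} {ρ ρ₂ : Site (d + 1)} {M' : Fin (d + 1) → ℕ} [∀ μ, NeZero (M' μ)] [NeZero N]

/-- [folklore] **`P · (f-WEIGHTED TIP CONTACT) = (combRowsT″ · D_f↾Res″)∘(e.symm, e.symm) · evalC`** (the twin of `CombSlicePathInverse.bigComb_PW0_eq` for the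
tip-type jets): with `P` the big comb rows re-indexed by `resBigEquiv` on the field slots (the torus call's `hP`), and the TIP-TYPE generator matrix
`D_f q s := Sum.elim (fun a => f (q.1, a)·tdelta (q.1 + e_a) s) (fun _ => 0) q.2` on the torus indices. -/
theorem bigComb_P_mul_eval_eq (hN : 0 < N) (hρ : ∀ i, 0 ≤ ρ i ∧ ρ i < N) (hN₂ : 0 < N₂) (hρ₂ : ∀ i, 0 ≤ ρ₂ i ∧ ρ₂ i < N₂) (hM' : ∀ i, N₂ ∣ M' i)
    (f : ↥(pbox (fine N M')) × Fin (d + 1) → ℝ) :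
    ((combRowsT ((N : ℤ) • ρ₂ + ρ) (N * N₂) (fine N M')).submatrix (resBigEquiv N N₂ ρ ρ₂ M' hN hρ hN₂ hρ₂).symm
          (fun b : ↥(pbox (fine N M')) × Fin (d + 1) => ((b.1, Sum.inl b.2) : Idx (fine N M') (Fib d))))
        * Matrix.of (fun (b : ↥(pbox (fine N M')) × Fin (d + 1)) (e : Res ρ₂ N₂ M' ⊕ Res ρ N (fine N M')) =>
            f b * Sum.elim (fun t : Res ρ₂ N₂ M' => tdelta M' (quo N ((b.1 : Site (d + 1)) + unitVec b.2)) t.1)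
              (fun s : Res ρ N (fine N M') => tdelta (fine N M') ((b.1 : Site (d + 1)) + unitVec b.2) s.1) e)
      = (combRowsT ((N : ℤ) • ρ₂ + ρ) (N * N₂) (fine N M')
            * (Matrix.of fun (q : Idx (fine N M') (Fib d)) (s : ↥(pbox (fine N M'))) =>
                Sum.elim (fun a : Fin (d + 1) => f (q.1, a) * tdelta (fine N M') ((q.1 : Site (d + 1)) + unitVec a) s) (fun _ => (0 : ℝ)) q.2).submatrix
              id (fun s : Res ((N : ℤ) • ρ₂ + ρ) (N * N₂) (fine N M') => s.1)).submatrix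
          (resBigEquiv N N₂ ρ ρ₂ M' hN hρ hN₂ hρ₂).symm (resBigEquiv N N₂ ρ ρ₂ M' hN hρ hN₂ hρ₂).symm
        * evalC N N₂ ρ ρ₂ M' := by
  set e := resBigEquiv N N₂ ρ ρ₂ M' hN hρ hN₂ hρ₂ with he
  set Df : Matrix (Idx (fine N M') (Fib d)) ↥(pbox (fine N M')) ℝ := Matrix.of fun (q : Idx (fine N M') (Fib d)) (s : ↥(pbox (fine N M'))) =>
      Sum.elim (fun a : Fin (d + 1) => f (q.1, a) * tdelta (fine N M') ((q.1 : Site (d + 1)) + unitVec a) s) (fun _ => (0 : ℝ)) q.2 with hDf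
  -- the weighted tip contact in the big basis, read on the field slots
  have hW : Matrix.of (fun (b : ↥(pbox (fine N M')) × Fin (d + 1)) (e' : Res ρ₂ N₂ M' ⊕ Res ρ N (fine N M')) =>
        f b * Sum.elim (fun t : Res ρ₂ N₂ M' => tdelta M' (quo N ((b.1 : Site (d + 1)) + unitVec b.2)) t.1)
          (fun s : Res ρ N (fine N M') => tdelta (fine N M') ((b.1 : Site (d + 1)) + unitVec b.2) s.1) e')
      = ((Df.submatrix id (fun s : Res ((N : ℤ) • ρ₂ + ρ) (N * N₂) (fine N M') => s.1)).submatrix id e.symm).submatrix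
            (fun b : ↥(pbox (fine N M')) × Fin (d + 1) => ((b.1, Sum.inl b.2) : Idx (fine N M') (Fib d))) id
          * evalC N N₂ ρ ρ₂ M' := by
    have hev := eval_eq (M' := M') hN hρ hN₂ hρ₂ (fun b : ↥(pbox (fine N M')) × Fin (d + 1) => (b.1 : Site (d + 1)) + unitVec b.2)
    have hdiag : Matrix.of (fun (b : ↥(pbox (fine N M')) × Fin (d + 1)) (e' : Res ρ₂ N₂ M' ⊕ Res ρ N (fine N M')) =>
          f b * Sum.elim (fun t : Res ρ₂ N₂ M' => tdelta M' (quo N ((b.1 : Site (d + 1)) + unitVec b.2)) t.1)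
            (fun s : Res ρ N (fine N M') => tdelta (fine N M') ((b.1 : Site (d + 1)) + unitVec b.2) s.1) e')
        = Matrix.diagonal f * Matrix.of (fun (b : ↥(pbox (fine N M')) × Fin (d + 1)) (e' : Res ρ₂ N₂ M' ⊕ Res ρ N (fine N M')) =>
            Sum.elim (fun t : Res ρ₂ N₂ M' => tdelta M' (quo N ((b.1 : Site (d + 1)) + unitVec b.2)) t.1)
              (fun s : Res ρ N (fine N M') => tdelta (fine N M') ((b.1 : Site (d + 1)) + unitVec b.2) s.1) e') := by
      ext b e'; simp only [Matrix.diagonal_mul, Matrix.of_apply]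
    have hsub : Matrix.diagonal f * (Matrix.of fun (b : ↥(pbox (fine N M')) × Fin (d + 1)) (x : Res ((N : ℤ) • ρ₂ + ρ) (N * N₂) (fine N M')) =>
          tdelta (fine N M') ((b.1 : Site (d + 1)) + unitVec b.2) x.1).submatrix id e.symm
        = ((Df.submatrix id (fun s : Res ((N : ℤ) • ρ₂ + ρ) (N * N₂) (fine N M') => s.1)).submatrix id e.symm).submatrix
            (fun b : ↥(pbox (fine N M')) × Fin (d + 1) => ((b.1, Sum.inl b.2) : Idx (fine N M') (Fib d))) id := by
      ext b x
      simp only [Matrix.diagonal_mul, Matrix.submatrix_apply, Matrix.of_apply, id_eq, hDf, Sum.elim_inl]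
    rw [hdiag, hev, ← Matrix.mul_assoc, hsub]
  rw [hW, ← Matrix.mul_assoc, combRowsT_fieldSlot_mul (Nat.mul_pos hN hN₂) (bigRoot_bounds hN hρ hρ₂) (fine_dvd hM'), submatrix_mul_submatrix]

end BigComb

/-! ## §3 The forest letters for the exponential tip-type jets on ANY comb: locality, diagonal `±1`, per-site square ⇒ `secondVar = 0` -/

section Forest

variable {ρ : Site (d + 1)} {N : ℕ} {M : Fin (d + 1) → ℕ}

/-- [folklore] the tip-type generator matrix on the comb bond into `x` reads `f(bond) · [tipOf x = s]`. -/
theorem tipJet_combBondT (hN : 0 < N) (hρ : ∀ i, 0 ≤ ρ i ∧ ρ i < N) (hM : ∀ i, N ∣ M i) (f : ↥(pbox M) × Fin (d + 1) → ℝ) (x : Res ρ N M)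
    (s : ↥(pbox M)) :
    (Matrix.of fun (q : Idx M (Fib d)) (s : ↥(pbox M)) =>
        Sum.elim (fun a : Fin (d + 1) => f (q.1, a) * tdelta M ((q.1 : Site (d + 1)) + unitVec a) s) (fun _ => (0 : ℝ)) q.2) (combBondT ρ N M x) s
      = f (⟨baseOf ρ N x.site, baseOf_mem_pbox hN hρ hM x⟩, axisOf ρ N x.site) * (if tipOf ρ N x.site = (s : Site (d + 1)) then 1 else 0) := by
  rw [combBondT_eq hN hρ hM x, Matrix.of_apply, Sum.elim_inl]
  show f _ * tdelta M (baseOf ρ N x.site + unitVec (axisOf ρ N x.site)) s = _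
  rw [show baseOf ρ N x.site + unitVec (axisOf ρ N x.site) = tipOf ρ N x.site from rfl, tdelta_of_mem M (tipOf_mem_pbox hN hρ hM x) s]

/-- [folklore] the comb predecessor is a different site. -/
theorem stepOf_ne_site (hN : 0 < N) (hρ : ∀ i, 0 ≤ ρ i ∧ ρ i < N) (x : Res ρ N M) : stepOf ρ N x.site ≠ x.site := by
  intro h
  have hlt := depth_stepOf_lt hN hρ x.not_root
  rw [h] at hlt
  exact lt_irrefl _ hlt

/-- [folklore] **COMB-LOCALITY OF THE GRADIENT ROWS**: `tgrad M` on the comb bond into `x` is supported on the columns `x`, `stepOf x`. -/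
theorem tgrad_combLocal (hN : 0 < N) (hρ : ∀ i, 0 ≤ ρ i ∧ ρ i < N) (hM : ∀ i, N ∣ M i) (x : Res ρ N M) (s : ↥(pbox M))
    (h : tgrad M (combBondT ρ N M x) s ≠ 0) : (s : Site (d + 1)) = x.site ∨ (s : Site (d + 1)) = stepOf ρ N x.site := by
  rw [tgrad_combBondT hN hρ hM x s] at h
  by_cases hlt : rootOf ρ N x.site (axisOf ρ N x.site) < x.site (axisOf ρ N x.site)
  · rw [(base_tip_of_lt hlt).1, (base_tip_of_lt hlt).2] at h
    by_cases h1 : x.site = (s : Site (d + 1))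
    · exact Or.inl h1.symm
    · by_cases h2 : stepOf ρ N x.site = (s : Site (d + 1))
      · exact Or.inr h2.symm
      · rw [if_neg h1, if_neg h2, sub_zero] at h; exact absurd rfl h
  · rw [(base_tip_of_not_lt hlt).1, (base_tip_of_not_lt hlt).2] at h
    by_cases h1 : x.site = (s : Site (d + 1))
    · exact Or.inl h1.symm
    · by_cases h2 : stepOf ρ N x.site = (s : Site (d + 1))
      · exact Or.inr h2.symm
      · rw [if_neg h1, if_neg h2, sub_zero] at h; exact absurd rfl h

/-- [folklore] **COMB-LOCALITY OF THE TIP-TYPE JETS**: `D_f` on the comb bond into `x` is supported on the tip column, which is `x` or `stepOf x`. -/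
theorem tipJet_combLocal (hN : 0 < N) (hρ : ∀ i, 0 ≤ ρ i ∧ ρ i < N) (hM : ∀ i, N ∣ M i) (f : ↥(pbox M) × Fin (d + 1) → ℝ) (x : Res ρ N M)
    (s : ↥(pbox M))
    (h : (Matrix.of fun (q : Idx M (Fib d)) (s : ↥(pbox M)) =>
        Sum.elim (fun a : Fin (d + 1) => f (q.1, a) * tdelta M ((q.1 : Site (d + 1)) + unitVec a) s) (fun _ => (0 : ℝ)) q.2) (combBondT ρ N M x) s ≠ 0) :
    (s : Site (d + 1)) = x.site ∨ (s : Site (d + 1)) = stepOf ρ N x.site := by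
  rw [tipJet_combBondT hN hρ hM f x s] at h
  have htip : tipOf ρ N x.site = (s : Site (d + 1)) := by
    by_contra hne; rw [if_neg hne, mul_zero] at h; exact h rfl
  by_cases hlt : rootOf ρ N x.site (axisOf ρ N x.site) < x.site (axisOf ρ N x.site)
  · rw [(base_tip_of_lt hlt).2] at htip; exact Or.inl htip.symm
  · rw [(base_tip_of_not_lt hlt).2] at htip; exact Or.inr htip.symm

/-- [folklore] **THE ONE-SHOT FP 2-JET OF THE EXPONENTIAL JETS VANISHES ON ANY COMB, ALONG ANY DIRECTION**: for every weight `w` and constant `c`,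
`secondVar (T·tgrad↾Res) (T·D_{−cw}↾Res) (T·D_{(cw)²}↾Res) = 0`, `T = combRowsT ρ N M` — forest-triangular with per-site `d₀·d₂ = d₁²`
(`1·(cw)² = (−cw)²` on a tip-oriented comb bond, `(−1)·0 = 0²` on a base-oriented one). -/
theorem secondVar_combRowsT_expJets_eq_zero (hN : 0 < N) (hρ : ∀ i, 0 ≤ ρ i ∧ ρ i < N) (hM : ∀ i, N ∣ M i) (c : ℝ)
    (w : ↥(pbox M) × Fin (d + 1) → ℝ) :
    secondVar (combRowsT ρ N M * (tgrad M).submatrix id Subtype.val)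
      (combRowsT ρ N M * (Matrix.of fun (q : Idx M (Fib d)) (s : ↥(pbox M)) =>
          Sum.elim (fun a : Fin (d + 1) => -(c * w (q.1, a)) * tdelta M ((q.1 : Site (d + 1)) + unitVec a) s) (fun _ => (0 : ℝ)) q.2).submatrix
        id Subtype.val)
      (combRowsT ρ N M * (Matrix.of fun (q : Idx M (Fib d)) (s : ↥(pbox M)) =>
          Sum.elim (fun a : Fin (d + 1) => (c * w (q.1, a)) ^ 2 * tdelta M ((q.1 : Site (d + 1)) + unitVec a) s) (fun _ => (0 : ℝ)) q.2).submatrix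
        id Subtype.val) = 0 := by
  refine secondVar_combRowsT_jets_eq_zero hN hρ hM _ _ _ (tgrad_combLocal hN hρ hM) (tipJet_combLocal hN hρ hM fun b => -(c * w b))
    (tipJet_combLocal hN hρ hM fun b => (c * w b) ^ 2) (fun x => ?_) (fun x => ?_)
  · -- diagonal `±1`
    rw [tgrad_combBondT hN hρ hM x x.1]
    by_cases hlt : rootOf ρ N x.site (axisOf ρ N x.site) < x.site (axisOf ρ N x.site)
    · rw [(base_tip_of_lt hlt).1, (base_tip_of_lt hlt).2, if_pos rfl, if_neg (stepOf_ne_site hN hρ x)]; norm_num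
    · rw [(base_tip_of_not_lt hlt).1, (base_tip_of_not_lt hlt).2, if_neg (stepOf_ne_site hN hρ x), if_pos rfl]; norm_num
  · -- per-site square
    rw [tgrad_combBondT hN hρ hM x x.1, tipJet_combBondT hN hρ hM (fun b => -(c * w b)) x x.1,
      tipJet_combBondT hN hρ hM (fun b => (c * w b) ^ 2) x x.1]
    by_cases hlt : rootOf ρ N x.site (axisOf ρ N x.site) < x.site (axisOf ρ N x.site)
    · have htip : tipOf ρ N x.site = ((x.1 : ↥(pbox M)) : Site (d + 1)) := (base_tip_of_lt hlt).2
      have hbase : ¬ baseOf ρ N x.site = ((x.1 : ↥(pbox M)) : Site (d + 1)) := by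
        rw [(base_tip_of_lt hlt).1]; exact stepOf_ne_site hN hρ x
      rw [if_pos htip, if_neg hbase]; ring
    · have htip : ¬ tipOf ρ N x.site = ((x.1 : ↥(pbox M)) : Site (d + 1)) := by
        rw [(base_tip_of_not_lt hlt).2]; exact stepOf_ne_site hN hρ x
      have hbase : baseOf ρ N x.site = ((x.1 : ↥(pbox M)) : Site (d + 1)) := (base_tip_of_not_lt hlt).1
      rw [if_neg htip, if_pos hbase]; ring

end Forest

/-! ## §4 At the torus call's literal: `uP♯` is automatic for the exponential one-shot generator jets, along every direction -/

section Torus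

variable (M' : Fin (d + 1) → ℕ) [∀ μ, NeZero (M' μ)] {Lc : ℕ} [NeZero Lc] {r r' : Fin (d + 1) → ℕ}

/-- [folklore] **`uP♯` IS AUTOMATIC — THE ONE-SHOT FADDEEV–POPOV 2-JET VANISHES FOR THE EXPONENTIAL GENERATOR JETS ALONG EVERY DIRECTION.**  At the torus
call's literal one-shot slice `P` (p313662 ∕ (B) ∕ S1 `hP` VERBATIM) and generator `W₀ = fromCols D₂ D₁` (`hD₁ hD₂` VERBATIM), for EVERY bond weight `w` and
every `c`, with the one-shot chart's generator jets in the exponential closed forms `W₁ = of(−(c·w b·Tip b e))`, `W₂ = of((c·w b)²·Tip b e)`: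
`secondVar (P * fromCols D₂ D₁) (P * W₁) (P * W₂) = 0` — the `uP♯` binder of `NestedStepLawTransported.secondVar_oneShot_nestedStepLaw_transported_of_uni`
(`W♯₀ := W₀`), e.g. at `w := h + Dλ` for ANY `h`, `λ`: no dead row, no comb-support hypothesis. -/
theorem torus_uP_exp (hr : r ∈ box (d + 1) Lc) (hr' : r' ∈ box (d + 1) Lc) (hM' : ∀ i, Lc ∣ M' i)
    {P : Matrix (Res (toSite r') Lc M' ⊕ Res (toSite r) Lc (fine Lc M')) (↥(pbox (fine Lc M')) × Fin (d + 1)) ℝ}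
    (hP : P = (combRowsT ((Lc : ℤ) • toSite r' + toSite r) (Lc * Lc) (fine Lc M')).submatrix
        (resBigEquiv Lc Lc (toSite r) (toSite r') M' (Nat.pos_of_ne_zero (NeZero.ne Lc)) (toSite_mem_range hr)
          (Nat.pos_of_ne_zero (NeZero.ne Lc)) (toSite_mem_range hr')).symm
        (fun b : ↥(pbox (fine Lc M')) × Fin (d + 1) => ((b.1, Sum.inl b.2) : Idx (fine Lc M') (Fib d))))
    {D₁ : Matrix (↥(pbox (fine Lc M')) × Fin (d + 1)) (Res (toSite r) Lc (fine Lc M')) ℝ}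
    {D₂ : Matrix (↥(pbox (fine Lc M')) × Fin (d + 1)) (Res (toSite r') Lc M') ℝ}
    (hD₁ : D₁ = (tgrad (fine Lc M')).submatrix (fun b : ↥(pbox (fine Lc M')) × Fin (d + 1) => ((b.1, Sum.inl b.2) : Idx (fine Lc M') (Fib d)))
        (Subtype.val : Res (toSite r) Lc (fine Lc M') → ↥(pbox (fine Lc M'))))
    (hD₂ : D₂ = (tgradBlock M' Lc).submatrix (fun b : ↥(pbox (fine Lc M')) × Fin (d + 1) => ((b.1, Sum.inl b.2) : Idx (fine Lc M') (Fib d)))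
        (Subtype.val : Res (toSite r') Lc M' → ↥(pbox M')))
    (c : ℝ) (w : ↥(pbox (fine Lc M')) × Fin (d + 1) → ℝ)
    {W₁ W₂ : Matrix (↥(pbox (fine Lc M')) × Fin (d + 1)) (Res (toSite r') Lc M' ⊕ Res (toSite r) Lc (fine Lc M')) ℝ}
    (hW₁ : W₁ = Matrix.of fun (b : ↥(pbox (fine Lc M')) × Fin (d + 1)) (e : Res (toSite r') Lc M' ⊕ Res (toSite r) Lc (fine Lc M')) =>
        -(c * w b * Sum.elim (fun t : Res (toSite r') Lc M' => tdelta M' (quo Lc ((b.1 : Site (d + 1)) + unitVec b.2)) t.1)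
          (fun s : Res (toSite r) Lc (fine Lc M') => tdelta (fine Lc M') ((b.1 : Site (d + 1)) + unitVec b.2) s.1) e))
    (hW₂ : W₂ = Matrix.of fun (b : ↥(pbox (fine Lc M')) × Fin (d + 1)) (e : Res (toSite r') Lc M' ⊕ Res (toSite r) Lc (fine Lc M')) =>
        (c * w b) ^ 2 * Sum.elim (fun t : Res (toSite r') Lc M' => tdelta M' (quo Lc ((b.1 : Site (d + 1)) + unitVec b.2)) t.1)
          (fun s : Res (toSite r) Lc (fine Lc M') => tdelta (fine Lc M') ((b.1 : Site (d + 1)) + unitVec b.2) s.1) e) :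
    secondVar (P * fromCols D₂ D₁) (P * W₁) (P * W₂) = 0 := by
  have hLc : 0 < Lc := Nat.pos_of_ne_zero (NeZero.ne Lc)
  -- the first jet as an `f`-weighted tip contact
  have hW₁' : W₁ = Matrix.of fun (b : ↥(pbox (fine Lc M')) × Fin (d + 1)) (e' : Res (toSite r') Lc M' ⊕ Res (toSite r) Lc (fine Lc M')) =>
        -(c * w b) * Sum.elim (fun t : Res (toSite r') Lc M' => tdelta M' (quo Lc ((b.1 : Site (d + 1)) + unitVec b.2)) t.1)
          (fun s : Res (toSite r) Lc (fine Lc M') => tdelta (fine Lc M') ((b.1 : Site (d + 1)) + unitVec b.2) s.1) e' := by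
    rw [hW₁]; ext b e'; simp only [Matrix.of_apply]; ring
  -- the three one-shot FP jets factor through the big comb's own basis
  have h0 : P * fromCols D₂ D₁
      = (combRowsT ((Lc : ℤ) • toSite r' + toSite r) (Lc * Lc) (fine Lc M')
            * (tgrad (fine Lc M')).submatrix id (fun s : Res ((Lc : ℤ) • toSite r' + toSite r) (Lc * Lc) (fine Lc M') => s.1)).submatrix
          (resBigEquiv Lc Lc (toSite r) (toSite r') M' hLc (toSite_mem_range hr) hLc (toSite_mem_range hr')).symm
          (resBigEquiv Lc Lc (toSite r) (toSite r') M' hLc (toSite_mem_range hr) hLc (toSite_mem_range hr')).symm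
        * evalC Lc Lc (toSite r) (toSite r') M' := by
    rw [hP, hD₁, hD₂]; exact bigComb_PW0_eq (M' := M') hLc (toSite_mem_range hr) hLc (toSite_mem_range hr') hM'
  have h1 : P * W₁
      = (combRowsT ((Lc : ℤ) • toSite r' + toSite r) (Lc * Lc) (fine Lc M')
            * (Matrix.of fun (q : Idx (fine Lc M') (Fib d)) (s : ↥(pbox (fine Lc M'))) =>
                Sum.elim (fun a : Fin (d + 1) => -(c * w (q.1, a)) * tdelta (fine Lc M') ((q.1 : Site (d + 1)) + unitVec a) s)
                  (fun _ => (0 : ℝ)) q.2).submatrix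
              id (fun s : Res ((Lc : ℤ) • toSite r' + toSite r) (Lc * Lc) (fine Lc M') => s.1)).submatrix
          (resBigEquiv Lc Lc (toSite r) (toSite r') M' hLc (toSite_mem_range hr) hLc (toSite_mem_range hr')).symm
          (resBigEquiv Lc Lc (toSite r) (toSite r') M' hLc (toSite_mem_range hr) hLc (toSite_mem_range hr')).symm
        * evalC Lc Lc (toSite r) (toSite r') M' := by
    rw [hP, hW₁']
    exact bigComb_P_mul_eval_eq (M' := M') hLc (toSite_mem_range hr) hLc (toSite_mem_range hr') hM'
      (fun b : ↥(pbox (fine Lc M')) × Fin (d + 1) => -(c * w b))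
  have h2 : P * W₂
      = (combRowsT ((Lc : ℤ) • toSite r' + toSite r) (Lc * Lc) (fine Lc M')
            * (Matrix.of fun (q : Idx (fine Lc M') (Fib d)) (s : ↥(pbox (fine Lc M'))) =>
                Sum.elim (fun a : Fin (d + 1) => (c * w (q.1, a)) ^ 2 * tdelta (fine Lc M') ((q.1 : Site (d + 1)) + unitVec a) s)
                  (fun _ => (0 : ℝ)) q.2).submatrix
              id (fun s : Res ((Lc : ℤ) • toSite r' + toSite r) (Lc * Lc) (fine Lc M') => s.1)).submatrix
          (resBigEquiv Lc Lc (toSite r) (toSite r') M' hLc (toSite_mem_range hr) hLc (toSite_mem_range hr')).symm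
          (resBigEquiv Lc Lc (toSite r) (toSite r') M' hLc (toSite_mem_range hr) hLc (toSite_mem_range hr')).symm
        * evalC Lc Lc (toSite r) (toSite r') M' := by
    rw [hP, hW₂]
    exact bigComb_P_mul_eval_eq (M' := M') hLc (toSite_mem_range hr) hLc (toSite_mem_range hr') hM'
      (fun b : ↥(pbox (fine Lc M')) × Fin (d + 1) => (c * w b) ^ 2)
  have hC : IsUnit (evalC Lc Lc (toSite r) (toSite r') M').det := by rw [det_evalC]; exact isUnit_one
  rw [h0, h1, h2, secondVar_mul_right _ _ _ _ hC, secondVar_submatrix_equiv]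
  exact secondVar_combRowsT_expJets_eq_zero (Nat.mul_pos hLc hLc) (bigRoot_bounds hLc (toSite_mem_range hr) (toSite_mem_range hr')) (fine_dvd hM') c w

end Torus

end Summit.QuantumFields.BalabanUV.Beta.FP.TorusOneShotFPExponential

end
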